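import Mathlib
import Summits.NavierStokesRegularity.NavierStokesRegularity.Theses.TypeILiouville
import Literature.Analysis.FluidPDE.LeiZhang2011RegularitySmoothDatum
import Literature.Analysis.FluidPDE.NSLocalClassical
import HarnessLib

/-!
# `TypeILiouville.TypeIliouvilleLocalClassical` — local classical Leray–Hopf solutions for Clay data

Route `TypeILiouville`, item stmt-NavierStokesRegularity-0059 (support, rank 5; the input of the
route's assembly). For `ν > 0` and a smooth, divergence-free, rapidly decaying datum `u₀ : ℝ³ → ℝ³`
there are `T > 0` and a classical solution `(u, p)` of the unforced Navier–Stokes system on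
`[0, T) × ℝ³` with `u 0 = u₀` which is a Leray–Hopf weak solution on `[0, T]` from `u₀`.

PROOF. The tree PROVES Tao's local existence theorem `tao2011_smooth_local_existence_holds`
(Tao 2013, Thm. 5.4 (ii)+(iv): smooth divergence-free `H^∞` data, lifespan `T` with
`‖u₀‖⁴_{H¹} T ≤ c ν³`, classical solution on the CLOSED slab `[0, T]` with all Sobolev norms bounded
and `u ∈ C([0,T]; L²)`), and that such solutions are Leray–Hopf
(`isLerayHopfOn_of_hasBoundedSobolevNormsOn`). A rapidly decaying smooth datum is `H^∞`
(`HasRapidSpatialDecay.lintegral_enorm_iteratedFDeriv_sq_lt_top`); its `H¹` size `A` is finite;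
take `T = c ν³/(A² + 1)`; restrict the classical solution from `Icc 0 T` to `Ico 0 T`. The two
`IsDivFree` predicates (`NSWave0.` in the item, `VectorCalculus.` in Tao's fact) are the same term.
This discharges the route's named-fact input `Literature.Analysis.FluidPDE.local_classical_lerayHopf`
(stated, not proved, in `NSLocalClassical.lean`) — see `local_classical_lerayHopf_holds` below.

HONEST FRAMING: a short-time existence statement (known since Leray 1934), assembled from tree
theorems; nothing here bears on the regularity problem itself.
-/

noncomputable section

set_option linter.dupNamespace false

namespace Summit.NavierStokesRegularity.NavierStokesRegularity.Theorems

open MeasureTheory Set Function Filter Topology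
open scoped ENNReal NNReal ContDiff
open Literature.Analysis.FluidPDE

/-- **Local classical Leray–Hopf solutions for Clay data** (Leray 1934 §III §19; here from the
tree's proof of Tao 2013 Thm. 5.4): for `ν > 0` and `u₀` smooth, divergence free and rapidly
decaying there are `T > 0` and a classical solution `(u, p)` on `Ico 0 T` with `u 0 = u₀` that is
Leray–Hopf on `[0, T]` from `u₀`. This is the named fact
`Literature.Analysis.FluidPDE.local_classical_lerayHopf`, now a theorem. [this file] -/
theorem local_classical_lerayHopf_holds : Literature.Analysis.FluidPDE.local_classical_lerayHopf := by
  intro ν hν u₀ h0 h0div h0dec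
  obtain ⟨c, hc, htao⟩ := tao2011_smooth_local_existence_holds
  -- the datum is `H^∞`
  have h0sob : ∀ n : ℕ, ∫⁻ x, ‖iteratedFDeriv ℝ n u₀ x‖ₑ ^ 2 < ⊤ := fun n =>
    h0dec.lintegral_enorm_iteratedFDeriv_sq_lt_top n
  have h0div' : VectorCalculus.IsDivFree u₀ := fun x => h0div x
  -- the `H¹` size of the datum
  set Atop : ℝ≥0∞ := (∫⁻ x, ‖u₀ x‖ₑ ^ 2) +
    ∫⁻ x, ENNReal.ofReal (frobeniusNormSq (fderiv ℝ u₀ x)) with hAtop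
  have hAfin : Atop < ⊤ := by
    refine ENNReal.add_lt_top.2 ⟨?_, ?_⟩
    · rw [lintegral_enorm_sq_eq_lintegral_iteratedFDeriv_zero]; exact h0sob 0
    · exact lt_of_le_of_lt (lintegral_frobeniusNormSq_le_three_mul u₀)
        (ENNReal.mul_lt_top (by simp) (h0sob 1))
  set A : ℝ := Atop.toReal with hAdef
  have hA0 : 0 ≤ A := ENNReal.toReal_nonneg
  have hAle : Atop ≤ ENNReal.ofReal A := (ENNReal.ofReal_toReal hAfin.ne).ge
  -- the lifespan `T = c ν³ / (A² + 1)`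
  set T : ℝ := c * ν ^ 3 / (A ^ 2 + 1) with hTdef
  have hT : 0 < T := by positivity
  have hTc : A ^ 2 * T ≤ c * ν ^ 3 := by
    rw [hTdef, mul_div_assoc', div_le_iff₀ (by positivity)]
    nlinarith [sq_nonneg A, mul_pos hc (pow_pos hν 3)]
  obtain ⟨u, p, hcl, hu0, hsob, -, hp, hcont⟩ := htao hν hT h0 h0div' h0sob hA0 hAle hTc
  refine ⟨T, hT, u, p, hcl.mono Ico_subset_Icc_self (uniqueDiffOn_Ico 0 T), hu0, ?_⟩
  rw [← hu0]
  exact isLerayHopfOn_of_hasBoundedSobolevNormsOn hT hcl hsob hp hcont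

/-- **Item stmt-NavierStokesRegularity-0059** (`TypeILiouville.TypeIliouvilleLocalClassical`, the
assembly's input): local classical Leray–Hopf solutions for Clay data — literally the route decl,
by `local_classical_lerayHopf_holds`. [this file] -/
theorem typeIliouville_local_classical_proof :
    Summit.NavierStokesRegularity.NavierStokesRegularity.Theses.TypeILiouville.TypeIliouvilleLocalClassical := by
  unfold Summit.NavierStokesRegularity.NavierStokesRegularity.Theses.TypeILiouville.TypeIliouvilleLocalClassical
  intro ν hν u₀ h0 h0div h0dec
  exact local_classical_lerayHopf_holds ν hν u₀ h0 h0div h0dec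

end Summit.NavierStokesRegularity.NavierStokesRegularity.Theorems

end
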